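import Literature.NumberTheory.QuadraticFields.FundamentalDiscriminant
import Literature.NumberTheory.QuadraticFields.IdealsOfPrimePowerNorm
import Mathlib.RingTheory.Ideal.Norm.AbsNorm
import Mathlib.RingTheory.DedekindDomain.Ideal.Lemmas
import Mathlib.RingTheory.Coprime.Lemmas
import Mathlib.Data.Nat.Squarefree
import HarnessLib

/-!
# The ramified primes of `ℚ(√-n)`: `𝔭_p = (p, √-n)`, `𝔭_p² = (p)`, `N𝔭_p = p`, `(√-n) = ∏_{p ∣ n} 𝔭_p`

Topic `NumberTheory/QuadraticFields`, namespace `Literature.NumberTheory.QuadraticFields.RedeiReichardt`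
(towards the Rédei–Reichardt theorem `redeiReichardt_fourTwoCard_classGroup`, Li–Ma 2008 Thm. 0.4 /
Stevenhagen 1995 §2).  Theorem-only file (no definition, no named fact).

Let `K` be a quadratic field and `x ∈ 𝓞_K` with `x² = -n`, `n ≥ 1` square-free, so that
`d_K = -n` or `-4n` and the primes dividing `d_K` — those of `n`, and `2` when `n ≡ 1, 2 (mod 4)` —
are the ramified ones (Li–Ma, Lemma 0.1).  Explicitly:

* `sq_span_pair_eq_span` — for a prime `p ∣ n`: `(p, x)² = (p)`; `sq_span_pair_two_eq_span` — for
  `n ≡ 1 (mod 4)`: `(2, 1 + x)² = (2)`;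
* `absNorm_eq_of_sq_eq_span`, `isMaximal_of_sq_eq_span`, `eq_of_sq_eq_span_of_mem`,
  `mk0_sq_eq_one_of_sq_eq_span` — an ideal `P` with `P² = (p)` has norm `p`, is maximal, is THE
  prime of `𝓞_K` containing `p` (the prime above a ramified `p` is unique), and `[P]² = 1`;
* `prod_span_pair_eq_span` — **`∏_{p ∣ n} (p, x) = (x)`** (both sides have norm `n` and `(x) ⊆ (p, x)`),
  the one relation among the ramified prime classes used in the `2 : 1` parametrisation of `Cl_K[2]`
  (Stevenhagen §2: the classes of the ramified primes generate the ambiguous classes, with the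
  single relation coming from `(√d)`).

## References

* Y. Li, L. Ma, Acta Arith. 134 (2008), Lemma 0.1 (the primes of `D`). [LiMa2008]
* P. Stevenhagen, *Rédei-matrices and applications*, LMS LNS 215 (1995), §2. [Stevenhagen1995RedeiMatrices]
* D. A. Marcus, *Number Fields*, 2nd ed. (2018), Ch. 3, Thm. 25 (splitting of primes in quadratic
  fields: `p ∣ d` ramifies as `(p, √d)²`). [Marcus2018]
-/

noncomputable section

open NumberField Ideal Module
open scoped nonZeroDivisors

namespace Literature.NumberTheory.QuadraticFields.RedeiReichardt

open Literature.NumberTheory.QuadraticFields.Quadratic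

variable {K : Type*} [Field K] [NumberField K]

/-! ### The integer `x = √-n` -/

omit [NumberField K] in
/-- An element of `K` with `x² = -n` gives an element of `𝓞_K` with the same property (`√-n` is an
algebraic integer). [cite: Marcus2018, Ch. 2 Cor. 2 of Thm. 1] -/
theorem exists_ringOfIntegers_sq_eq_neg {x : K} {n : ℕ} (hx : x ^ 2 = -(n : K)) :
    ∃ y : 𝓞 K, (y : K) = x ∧ y ^ 2 = -(n : 𝓞 K) := by
  have hint : IsIntegral ℤ x :=
    isIntegral_of_sq_eq_intCast (n := -(n : ℤ)) (by rw [hx]; push_cast; ring)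
  obtain ⟨y, hy⟩ := exists_coe_eq_of_isIntegral hint
  refine ⟨y, hy, RingOfIntegers.coe_injective ?_⟩
  change ((y ^ 2 : 𝓞 K) : K) = ((-(n : 𝓞 K) : 𝓞 K) : K)
  rw [RingOfIntegers.coe_eq_algebraMap, RingOfIntegers.coe_eq_algebraMap, map_pow, map_neg,
    map_natCast, ← RingOfIntegers.coe_eq_algebraMap, hy, hx]

/-! ### Ideals whose square is `(p)` -/

/-- `N((p)) = p²` in the ring of integers of a quadratic field (`‖(a)‖ = |N(a)|`).
[cite: Marcus2018, Ch. 3 Thm. 22] -/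
theorem absNorm_span_natCast (h2 : finrank ℚ K = 2) (p : ℕ) :
    absNorm (span {(p : 𝓞 K)}) = p ^ 2 := by
  rw [absNorm_span_singleton, ← map_natCast (algebraMap ℤ (𝓞 K)) p, Algebra.norm_algebraMap,
    NumberField.RingOfIntegers.rank, h2]
  simp [Int.natAbs_pow]

/-- **An ideal with `P² = (p)` has norm `p`.** [cite: Marcus2018, Ch. 3 Thm. 25] -/
theorem absNorm_eq_of_sq_eq_span (h2 : finrank ℚ K = 2) {p : ℕ} {P : Ideal (𝓞 K)}
    (hP : P ^ 2 = span {(p : 𝓞 K)}) : absNorm P = p := by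
  have h : absNorm P ^ 2 = p ^ 2 := by rw [← map_pow, hP, absNorm_span_natCast h2]
  exact Nat.pow_left_injective (by norm_num) h

/-- **An ideal with `P² = (p)`, `p` prime, is maximal.** [cite: Marcus2018, Ch. 3 Thm. 25] -/
theorem isMaximal_of_sq_eq_span (h2 : finrank ℚ K = 2) {p : ℕ} (hp : p.Prime) {P : Ideal (𝓞 K)}
    (hP : P ^ 2 = span {(p : 𝓞 K)}) : P.IsMaximal :=
  isMaximal_of_absNorm_eq_prime hp (absNorm_eq_of_sq_eq_span h2 hP)

/-- An ideal with `P² = (p)`, `p` prime, is nonzero (a non-zero-divisor). [cite: Marcus2018, Ch. 3 Thm. 25] -/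
theorem mem_nonZeroDivisors_of_sq_eq_span (h2 : finrank ℚ K = 2) {p : ℕ} (hp : p.Prime)
    {P : Ideal (𝓞 K)} (hP : P ^ 2 = span {(p : 𝓞 K)}) : P ∈ (Ideal (𝓞 K))⁰ := by
  rw [mem_nonZeroDivisors_iff_ne_zero]
  intro h0
  have h := absNorm_eq_of_sq_eq_span h2 hP
  rw [h0, Submodule.zero_eq_bot, absNorm_bot] at h
  exact hp.ne_zero h.symm

/-- **Uniqueness of the prime above a ramified prime**: if `P² = (p)` then every prime ideal `Q`
containing `p` equals `P` (`P² ⊆ Q` forces `P ⊆ Q`, and `P` is maximal).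
[cite: Marcus2018, Ch. 3 Thm. 25] -/
theorem eq_of_sq_eq_span_of_mem (h2 : finrank ℚ K = 2) {p : ℕ} (hp : p.Prime) {P Q : Ideal (𝓞 K)}
    (hP : P ^ 2 = span {(p : 𝓞 K)}) (hQ : Q.IsPrime) (hpQ : (p : 𝓞 K) ∈ Q) : Q = P := by
  haveI := isMaximal_of_sq_eq_span h2 hp hP
  have hle : P ^ 2 ≤ Q := by
    rw [hP, span_singleton_le_iff_mem]
    exact hpQ
  have hPQ : P ≤ Q := (Ideal.IsPrime.pow_le_iff (I := P) two_ne_zero).mp hle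
  exact (Ideal.IsMaximal.eq_of_le ‹P.IsMaximal› hQ.ne_top hPQ).symm

/-- The class of an ideal with `P² = (p)` has square `1`. [cite: Stevenhagen1995RedeiMatrices, §2] -/
theorem mk0_sq_eq_one_of_sq_eq_span {p : ℕ} (hp : p.Prime) {P : Ideal (𝓞 K)}
    (hP : P ^ 2 = span {(p : 𝓞 K)}) (hP0 : P ∈ (Ideal (𝓞 K))⁰) :
    ClassGroup.mk0 ⟨P, hP0⟩ ^ 2 = 1 := by
  have hp0 : span {(p : 𝓞 K)} ∈ (Ideal (𝓞 K))⁰ := by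
    rw [mem_nonZeroDivisors_iff_ne_zero, Ne, Submodule.zero_eq_bot, span_singleton_eq_bot]
    exact_mod_cast hp.ne_zero
  have h : (⟨P, hP0⟩ : (Ideal (𝓞 K))⁰) ^ 2 = ⟨span {(p : 𝓞 K)}, hp0⟩ := Subtype.ext (by
    rw [SubmonoidClass.mk_pow]; exact hP)
  rw [← map_pow, h, ClassGroup.mk0_eq_one_iff]
  exact ⟨⟨(p : 𝓞 K), rfl⟩⟩

/-! ### The primes `(p, x)` for `p ∣ n` and `(2, 1 + x)` for `n ≡ 1 (mod 4)` -/

section SqrtNeg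

variable {n : ℕ} (hn : Squarefree n) {x : 𝓞 K} (hx : x ^ 2 = -(n : 𝓞 K))
include hn hx

omit [NumberField K] in
/-- **`(p, x)² = (p)` for a prime `p ∣ n`** (`n` square-free, `x² = -n`): `(p, x)² = (p², px, -n)`,
and `p = ap² + bn` since `p ∥ n`. [cite: Marcus2018, Ch. 3 Thm. 25] -/
theorem sq_span_pair_eq_span {p : ℕ} (hp : p.Prime) (hpn : p ∣ n) :
    (span {(p : 𝓞 K), x} : Ideal (𝓞 K)) ^ 2 = span {(p : 𝓞 K)} := by
  have hx2 : x * x = -(n : 𝓞 K) := by rw [← sq, hx]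
  obtain ⟨m, rfl⟩ := hpn
  -- `p ∤ m` since `p·m` is square-free
  have hpm : Nat.Coprime p m := by
    rw [Nat.Prime.coprime_iff_not_dvd hp]
    intro hdvd
    obtain ⟨k, rfl⟩ := hdvd
    have : p * p ∣ p * (p * k) := ⟨k, by ring⟩
    exact hp.ne_one (Nat.isUnit_iff.mp (hn p this))
  rw [sq, span_pair_mul_span_pair]
  apply le_antisymm
  · -- every generator lies in `(p)`
    rw [span_le]
    intro y hy
    simp only [Set.mem_insert_iff, Set.mem_singleton_iff] at hy
    rw [SetLike.mem_coe, mem_span_singleton]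
    rcases hy with rfl | rfl | rfl | rfl
    · exact Dvd.intro _ rfl
    · exact Dvd.intro _ rfl
    · exact Dvd.intro_left _ rfl
    · rw [hx2]
      exact ⟨-(m : 𝓞 K), by push_cast; ring⟩
  · -- `p = a p² - b (x x)` lies in the product
    rw [span_singleton_le_iff_mem]
    obtain ⟨a, b, hab⟩ : ∃ a b : ℤ, a * p + b * m = 1 := by
      obtain ⟨a, b, h⟩ := Nat.Coprime.isCoprime hpm
      exact ⟨a, b, by linarith⟩
    have hmem1 : (p : 𝓞 K) * (p : 𝓞 K) ∈ span {(p : 𝓞 K) * p, (p : 𝓞 K) * x, x * p, x * x} :=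
      subset_span (by simp)
    have hmem2 : x * x ∈ span {(p : 𝓞 K) * p, (p : 𝓞 K) * x, x * p, x * x} :=
      subset_span (by simp)
    have hab' : (a : 𝓞 K) * p + (b : 𝓞 K) * m = 1 := by
      exact_mod_cast congrArg (fun z : ℤ => (z : 𝓞 K)) hab
    have key : (p : 𝓞 K) = (a : 𝓞 K) * ((p : 𝓞 K) * p) + (-(b : 𝓞 K)) * (x * x) := by
      rw [hx2]
      push_cast
      linear_combination (-(p : 𝓞 K)) * hab'
    have hmem : (a : 𝓞 K) * ((p : 𝓞 K) * p) + (-(b : 𝓞 K)) * (x * x) ∈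
        span {(p : 𝓞 K) * p, (p : 𝓞 K) * x, x * p, x * x} :=
      add_mem (mul_mem_left _ _ hmem1) (mul_mem_left _ _ hmem2)
    rwa [← key] at hmem

omit [NumberField K] hn in
/-- **`(2, 1 + x)² = (2)` for `n ≡ 1 (mod 4)`** (`x² = -n`): `(2, 1+x)² = (4, 2 + 2x, 1 - n + 2x)`
contains `(2 + 2x) - (1 - n + 2x) = n + 1 ≡ 2 (mod 4)`, hence `2`. [cite: Marcus2018, Ch. 3 Thm. 25] -/
theorem sq_span_pair_two_eq_span (hn4 : n % 4 = 1) :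
    (span {(2 : 𝓞 K), 1 + x} : Ideal (𝓞 K)) ^ 2 = span {((2 : ℕ) : 𝓞 K)} := by
  have hx2 : x * x = -(n : 𝓞 K) := by rw [← sq, hx]
  obtain ⟨k, hk⟩ : ∃ k : ℕ, n = 4 * k + 1 := ⟨n / 4, by omega⟩
  have hnk : (n : 𝓞 K) = 4 * k + 1 := by rw [hk]; push_cast; ring
  have hy2 : (1 + x) * (1 + x) = -(4 * (k : 𝓞 K)) + 2 * x := by
    linear_combination hx2 - hnk
  rw [sq, span_pair_mul_span_pair, Nat.cast_ofNat]
  apply le_antisymm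
  · rw [span_le]
    intro z hz
    simp only [Set.mem_insert_iff, Set.mem_singleton_iff] at hz
    rw [SetLike.mem_coe, mem_span_singleton]
    rcases hz with rfl | rfl | rfl | rfl
    · exact Dvd.intro _ rfl
    · exact Dvd.intro _ rfl
    · exact Dvd.intro_left _ rfl
    · rw [hy2]
      exact ⟨-(2 * k : 𝓞 K) + x, by ring⟩
  · rw [span_singleton_le_iff_mem]
    have hmem1 : (2 : 𝓞 K) * 2 ∈ span {(2 : 𝓞 K) * 2, (2 : 𝓞 K) * (1 + x), (1 + x) * 2, (1 + x) * (1 + x)} :=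
      subset_span (by simp)
    have hmem2 : (2 : 𝓞 K) * (1 + x) ∈
        span {(2 : 𝓞 K) * 2, (2 : 𝓞 K) * (1 + x), (1 + x) * 2, (1 + x) * (1 + x)} :=
      subset_span (by simp)
    have hmem3 : (1 + x) * (1 + x) ∈
        span {(2 : 𝓞 K) * 2, (2 : 𝓞 K) * (1 + x), (1 + x) * 2, (1 + x) * (1 + x)} :=
      subset_span (by simp)
    have key : (2 : 𝓞 K) =
        (-(k : 𝓞 K)) * ((2 : 𝓞 K) * 2) + 1 * ((2 : 𝓞 K) * (1 + x)) + (-1) * ((1 + x) * (1 + x)) := by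
      rw [hy2]; ring
    have hmem : (-(k : 𝓞 K)) * ((2 : 𝓞 K) * 2) + 1 * ((2 : 𝓞 K) * (1 + x)) +
        (-1) * ((1 + x) * (1 + x)) ∈
        span {(2 : 𝓞 K) * 2, (2 : 𝓞 K) * (1 + x), (1 + x) * 2, (1 + x) * (1 + x)} :=
      add_mem (add_mem (mul_mem_left _ _ hmem1) (mul_mem_left _ _ hmem2)) (mul_mem_left _ _ hmem3)
    rwa [← key] at hmem

omit [NumberField K] hn in
/-- **`(x)² = (n)`** as ideals (`x² = -n`). [cite: Marcus2018, Ch. 3 Thm. 22] -/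
theorem span_sqrt_neg_sq : (span {x} : Ideal (𝓞 K)) ^ 2 = span {((n : ℕ) : 𝓞 K)} := by
  rw [span_singleton_pow, hx, span_singleton_neg]

omit hn in
/-- `N((x)) = n` for `x² = -n` (`‖(x)‖ = |N(x)|`). [cite: Marcus2018, Ch. 3 Thm. 22] -/
theorem absNorm_span_sqrt_neg (h2 : finrank ℚ K = 2) : absNorm (span {x}) = n :=
  absNorm_eq_of_sq_eq_span h2 (span_sqrt_neg_sq hx)

/-- **`∏_{p ∣ n} (p, x) = (x)`**: each `(p, x)` contains `x`, the `(p, x)` are distinct maximal ideals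
(norms `p`), so their product divides `(x)`; both have norm `n = ∏_{p ∣ n} p`.
[cite: Stevenhagen1995RedeiMatrices, §2] -/
theorem prod_span_pair_eq_span (h2 : finrank ℚ K = 2) :
    ∏ p ∈ n.primeFactors, (span {(p : 𝓞 K), x} : Ideal (𝓞 K)) = span {x} := by
  classical
  have hn0 : n ≠ 0 := Squarefree.ne_zero hn
  have hsq : ∀ p ∈ n.primeFactors, (span {(p : 𝓞 K), x} : Ideal (𝓞 K)) ^ 2 = span {(p : 𝓞 K)} :=
    fun p hp => sq_span_pair_eq_span hn hx (Nat.prime_of_mem_primeFactors hp)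
      (Nat.dvd_of_mem_primeFactors hp)
  have hmax : ∀ p ∈ n.primeFactors, (span {(p : 𝓞 K), x} : Ideal (𝓞 K)).IsMaximal := fun p hp =>
    isMaximal_of_sq_eq_span h2 (Nat.prime_of_mem_primeFactors hp) (hsq p hp)
  have hnorm : ∀ p ∈ n.primeFactors, absNorm (span {(p : 𝓞 K), x} : Ideal (𝓞 K)) = p :=
    fun p hp => absNorm_eq_of_sq_eq_span h2 (hsq p hp)
  -- pairwise coprime
  have hcop : ((n.primeFactors : Finset ℕ) : Set ℕ).Pairwise
      (Function.onFun IsCoprime fun p : ℕ => (span {(p : 𝓞 K), x} : Ideal (𝓞 K))) := by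
    intro p hp q hq hpq
    have hmp := hmax p hp
    have hmq := hmax q hq
    refine (Ideal.isCoprime_iff_sup_eq).mpr (Ideal.IsMaximal.coprime_of_ne hmp hmq fun h => hpq ?_)
    have h' : (span {(p : 𝓞 K), x} : Ideal (𝓞 K)) = span {(q : 𝓞 K), x} := h
    have := hnorm p hp
    rw [h', hnorm q hq] at this
    exact this.symm
  -- the product divides `(x)`
  have hdvd : ∏ p ∈ n.primeFactors, (span {(p : 𝓞 K), x} : Ideal (𝓞 K)) ∣ span {x} := by
    refine Finset.prod_dvd_of_coprime hcop fun p _ => ?_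
    rw [dvd_iff_le, span_singleton_le_iff_mem]
    exact subset_span (by simp)
  obtain ⟨J, hJ⟩ := hdvd
  -- compare norms
  have hnormprod : absNorm (∏ p ∈ n.primeFactors, (span {(p : 𝓞 K), x} : Ideal (𝓞 K))) = n := by
    rw [map_prod, Finset.prod_congr rfl hnorm, Nat.prod_primeFactors_of_squarefree hn]
  have hJ1 : absNorm J = 1 := by
    have h := congrArg absNorm hJ
    rw [absNorm_span_sqrt_neg hx h2, map_mul, hnormprod] at h
    have : n * absNorm J = n * 1 := by rw [mul_one]; exact h.symm
    exact Nat.eq_of_mul_eq_mul_left (Nat.pos_of_ne_zero hn0) this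
  rw [absNorm_eq_one_iff] at hJ1
  rw [hJ1, Ideal.mul_top] at hJ
  exact hJ.symm

end SqrtNeg

end Literature.NumberTheory.QuadraticFields.RedeiReichardt

end
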